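import Literature.Probability.LatticeModels.WeightedCurrents
import HarnessLib

/-!
# Sakai's lace-expansion coefficients for the Ising model (random-current representation)

Topic `Probability/LatticeModels`, grouping namespace `IsingLace` (the objects of A. Sakai,
*Lace expansion for the Ising model*, CMP 272 (2007), §2). For the ferromagnetic Ising model with
uniform coupling `β` on a FINITE simple graph `G` (Sakai's `Λ` with bond set `𝔹_Λ = E(G)`;
his general couplings `J_b` are specialised to `J ≡ 1` on the edges, so `τ_b = tanh β`), this
file DEFINES, over the tree's random currents (`Current G = (E(G) → ℕ)`, weights
`w_β(n) = ∏_b β^{n_b}/n_b!`, sources `∂n`, traces, `Current.IsSupp`, `Current.connIn`,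
`Current.cluster`, `offGraph`; `RandomCurrents.lean`, `CurrentSwitching.lean`,
`WeightedCurrents.lean`):

* the restricted objects of §2.1, parametrised by the REMOVED vertex set `𝒜` (so that Sakai's
  bond set `𝔹_{𝒜ᶜ}` — the edges with both endpoints outside `𝒜` — is the tree's `offGraph G 𝒜`):
  the restricted partition function `Z_{𝒜ᶜ} = Σ_{∂m=∅, m ⊆ 𝔹_{𝒜ᶜ}} w(m)` (`zOff`, (2.3)–(2.4)) and
  the restricted two-point function `⟨φ_xφ_y⟩_{𝒜ᶜ}` (`twoPointOff`, (2.5): the free-boundary Ising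
  two-point function of the volume `𝒜ᶜ`, and `0` unless `x, y ∉ 𝒜`);
* the percolation-type notions of Definition 2.1 for a current `N`: `x ⟷_N y` (`Conn`, the
  tree's cluster membership `Current.cluster`), `x ⟷_N y in 𝒜ᶜ` (`ConnAvoid`, the tree's
  `Current.connIn (offGraph G 𝒜)`), connection through `𝒜` (`ConnThrough`, (2.7)), connection
  off a bond (`ConnOff`), the cluster `𝒞^b_N(x)` (`clusterOff`, a `Current.cluster`), pivotal
  directed bonds "for `x ⟷ y` from `x`" (`IsPivotal`), double connection `x ⟺_N y`
  (`IsDoublyConn`), and the event `E_N(v, x; 𝒜)` of (2.28) (`laceEvent`);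
* the operation `Θ_{v,x;𝒜}[X]` of (2.30) (`theta`: the normalised double sum over a sourceless
  current `m` on `𝔹_{𝒜ᶜ}` and a current `n` on `𝔹_Λ` with `∂n = v △ x`, of `1{E_{m+n}(v,x;𝒜)} X(m+n)`);
* the nested coefficients (2.39)–(2.40) by recursion on the nesting depth (`piKernel`,
  `rKernel`), and Sakai's `π^{(j)}_Λ(x)` (`coeff`), `R^{(j)}_Λ(x)` (`remainder`), `Π^{(j)}_Λ`
  (`coeffSum`, (1.12)); directed bonds are Mathlib's `G.Dart` (`b = (b̲, b̄) = (d.fst, d.snd)`).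

PROVED here (sanity of the transcription and bridges to the tree's API): nonnegativity of `Θ`,
`π^{(j)}` for `β ≥ 0` (`theta_nonneg`, `coeff_nonneg`); `conn_iff_mem_cluster`, `connAvoid_iff`;
`E_N(o,x;Λ) = {o ⟺_N x}` (`laceEvent_univ_iff`, the remark before (2.36)); `Z_∅ = 1`
(`zOff_univ`: only the zero current lives on no bonds — Sakai's convention `w_∅(m)/Z_∅ = 1{m ≡ 0}`),
`Z_Λ = currentSum G β ∅` (`zOff_empty`), `zOff = (ecurrentSumIn (offGraph G 𝒜) _ ∅).toReal`
(`zOff_eq_toReal_ecurrentSumIn`), and (2.10) = (2.36):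
`π^{(0)}_Λ(x) = Σ_{∂n = o△x} (w(n)/Z_Λ) 1{o ⟺_n x}` (`coeff_zero_eq`).

Stated as a NAMED FACT (not proved here): **Proposition 1.1** of Sakai 2007 for these objects —
the identity (1.11) for every `j` and the ferromagnetic bounds (1.13) (`Sakai2007_prop11`). Its
printed proof is §2.2 (first expansion by the first pivotal bond, (2.8)–(2.18); the "through"
identity Prop. 2.2 ((2.19)) from the source-switching Lemma 2.3 ((2.22)) — the tree's nested
switching lemma `Current.tsum_switching`, phrased with the same `Current.connIn`; second expansion
(2.28)–(2.35); nesting (2.36)–(2.42)); "the rest of that paper is secure" (Sakai 2022, §2.5, on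
the 2007 paper outside its §4).

Deliberately NOT here: the spread-out / box specialisation and Proposition 3.1 (the diagrammatic
`x`-space bounds), which live with the barrier `LaceExpansionIsingAboveFour`
(`Literature/Barriers/CriticalPhenomena/LaceExpansionIsingExpansionBounds.lean`); general
(non-uniform, possibly signed) couplings `J_b`.

## References

* A. Sakai, *Lace expansion for the Ising model*, Comm. Math. Phys. 272 (2007) 283–344,
  arXiv:math-ph/0510093: §1.2 (Prop. 1.1, (1.11)–(1.13)), §2.1 ((2.1)–(2.6)), §2.2 (Def. 2.1,
  (2.7)–(2.42), Prop. 2.2, Lemma 2.3) [Sakai2007].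
* A. Sakai, *Correct bounds on the Ising lace-expansion coefficients*, Comm. Math. Phys. 392
  (2022) 783–823, arXiv:2003.09856: §2.4–2.5 [Sakai2022].
(Equation numbers are those of the arXiv version held in the literature store, every display
counted.)
-/

noncomputable section

open Finset
open scoped symmDiff BigOperators

namespace Literature.Probability.LatticeModels

variable {V : Type*} [Fintype V] [DecidableEq V] (G : SimpleGraph V) [DecidableRel G.Adj]

namespace IsingLace

/-! ## Restricted partition functions and two-point functions (§2.1) -/

/-- The restricted partition function of the volume `𝒜ᶜ` (bond set `𝔹_{𝒜ᶜ} = offGraph G 𝒜`):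
`Z_{𝒜ᶜ} = Σ_{∂m = ∅, m ⊆ 𝔹_{𝒜ᶜ}} w_β(m)` ((2.3); by (2.4) the currents of the sub-bond-set are the
currents of `𝔹_Λ` vanishing off it, `Current.IsSupp`). `Z_Λ = zOff β ∅`; for `𝒜 = Λ` only the zero
current contributes and `Z_∅ = 1` (`zOff_univ`), which is Sakai's convention
`w_∅(m)/Z_∅ = 1{m ≡ 0}` (§2.2.3). A real `tsum` (absolutely convergent; it is the real part of the
tree's `ecurrentSumIn (offGraph G 𝒜) (fun _ => β) ∅`). [cite: Sakai2007, (2.3)–(2.4)] -/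
def zOff (β : ℝ) (A : Finset V) : ℝ :=
  ∑' n : Current G, if Current.IsSupp (offGraph G A) n ∧ n.sources = ∅ then n.weight β else 0

/-- The restricted two-point function `⟨φ_xφ_y⟩_{𝒜ᶜ}`: the free-boundary, zero-field two-point
function of the Ising model on the volume `𝒜ᶜ` (interaction on `𝔹_{𝒜ᶜ}`), and `0` if `x` or `y`
lies in `𝒜` ("If `x` or `y` is in `𝒜ᶜ` [here: in `𝒜`], then we define both sides of (2.5) to be
zero"). [cite: Sakai2007, (2.5)] -/
def twoPointOff (β : ℝ) (A : Finset V) (x y : V) : ℝ :=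
  if x ∉ A ∧ y ∉ A then isingTwoPoint G Aᶜ β 0 .free x y else 0

/-! ## Connectivity notions of Definition 2.1 -/

/-- `x ⟷_N y` (in `Λ`): `x = y`, or a path from `x` to `y` of bonds with positive current; i.e.
`y` lies in the cluster `C_N(x)` (`conn_iff_mem_cluster`). [cite: Sakai2007, Definition 2.1 (i)] -/
def Conn (N : Current G) (x y : V) : Prop := (Percolation.openGraph N.traced).Reachable x y

/-- `x ⟷_N y in 𝒜ᶜ`: "either `x = y ∈ 𝒜ᶜ` or there is a path from `x` to `y` consisting of bonds
`b ∈ 𝔹_{𝒜ᶜ}` with `n_b > 0`" — connection avoiding `𝒜`, the tree's `Current.connIn (offGraph G 𝒜)`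
together with the endpoint condition (automatic when `x ≠ y`). [cite: Sakai2007, Definition 2.1 (i)] -/
def ConnAvoid (N : Current G) (A : Finset V) (x y : V) : Prop :=
  x ∉ A ∧ y ∉ A ∧ N ∈ Current.connIn (offGraph G A) x y

/-- `x` is `N`-connected to `y` THROUGH `𝒜`: `{x ⟷_N y} ∖ {x ⟷_N y in 𝒜ᶜ}` ((2.7)).
[cite: Sakai2007, Definition 2.1 (i), (2.7)] -/
def ConnThrough (N : Current G) (A : Finset V) (x y : V) : Prop := Conn G N x y ∧ ¬ConnAvoid G N A x y

/-- The edge of `𝔹_Λ = E(G)` underlying a directed bond. [folklore] -/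
def dartEdge (d : G.Dart) : G.edgeFinset := ⟨d.edge, G.mem_edgeFinset.2 d.edge_mem⟩

/-- `x ⟷_N y off b`: the connection survives every change of `n_b`, i.e. (the event being
increasing) it holds with `n_b` set to `0`. [cite: Sakai2007, Definition 2.1 (ii) ({E off b})] -/
def ConnOff (N : Current G) (e : G.edgeFinset) (x y : V) : Prop := Conn G (Function.update N e 0) x y

/-- The cluster `𝒞^b_N(x) = {y : x ⟷_N y off b}` — the tree's cluster of `x` in the current with
`n_b` set to `0`. [cite: Sakai2007, Definition 2.1 (ii)] -/
def clusterOff (N : Current G) (e : G.edgeFinset) (x : V) : Finset V :=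
  Current.cluster (Function.update N e 0) x

/-- The directed bond `b = (b̲, b̄) = (d.fst, d.snd)` is PIVOTAL for `x ⟷_N y` from `x`:
`{x ⟷_N b̲ off b} ∩ {b̄ ⟷_N y in 𝒞^b_N(x)ᶜ}`. [cite: Sakai2007, Definition 2.1 (iii)] -/
def IsPivotal (N : Current G) (x y : V) (d : G.Dart) : Prop :=
  ConnOff G N (dartEdge G d) x d.fst ∧ ConnAvoid G N (clusterOff G N (dartEdge G d) x) d.snd y

/-- `x ⟺_N y`: "If `{x ⟷_N y}` occurs with no pivotal bonds, we say that `x` is `N`-doubly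
connected to `y`". [cite: Sakai2007, Definition 2.1 (iii)] -/
def IsDoublyConn (N : Current G) (x y : V) : Prop := Conn G N x y ∧ ¬∃ d : G.Dart, IsPivotal G N x y d

/-- The event `E_N(v, x; 𝒜) = {v ⟷_N x through 𝒜} ∩ {∄ pivotal bond b for v ⟷_N x from v such
that v ⟷_N b̲ through 𝒜}` ((2.28)). [cite: Sakai2007, (2.28)] -/
def laceEvent (N : Current G) (A : Finset V) (v x : V) : Prop :=
  ConnThrough G N A v x ∧ ¬∃ d : G.Dart, IsPivotal G N v x d ∧ ConnThrough G N A v d.fst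

/-! ## The operation `Θ` ((2.30)) and the nested coefficients ((2.39)–(2.40)) -/

open Classical in
/-- **Sakai's operation `Θ_{v,x;𝒜}[X]`** ((2.30)):
`Σ_{∂m = ∅, ∂n = v△x} (w_{𝒜ᶜ}(m)/Z_{𝒜ᶜ}) (w_Λ(n)/Z_Λ) 1{E_{m+n}(v,x;𝒜)} X(m+n)`, the current
`m` living on the bonds `𝔹_{𝒜ᶜ} = offGraph G 𝒜` (a current of `𝔹_Λ` supported there) and `n` on
`𝔹_Λ`; a `tsum` over pairs of currents (absolutely convergent for bounded `X`; junk value `0`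
otherwise). For `𝒜 = Λ`, `m` is forced to vanish and `Z_∅ = 1`, which is the convention
`w_∅(m)/Z_∅ = 1{m ≡ 0}` of §2.2.3. [cite: Sakai2007, (2.30)] -/
def theta (β : ℝ) (A : Finset V) (v x : V) (X : Current G → ℝ) : ℝ :=
  ∑' p : Current G × Current G,
    (if Current.IsSupp (offGraph G A) p.1 ∧ p.1.sources = ∅ then p.1.weight β / zOff G β A else 0) *
      (if p.2.sources = {v} ∆ {x} then p.2.weight β / zOff G β ∅ else 0) *
      (if laceEvent G (p.1 + p.2) A v x then X (p.1 + p.2) else 0)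

/-- The nested `Θ`-kernel of (2.39) with `k + 1` levels, with cluster variable `𝒜`, started at
the vertex `v` and ending at `x`:
`F_0(𝒜, v, x) = Θ_{v,x;𝒜}[1]`,
`F_{k+1}(𝒜, v, x) = Σ_b Θ_{v,b̲;𝒜}[ τ_b F_k(𝒞^b_{m+n}(v), b̄, x) ]`
(the operation `Θ^{(i)}` "determines the variable `𝒞̃_i = 𝒞^{b_{i+1}}_{m_i+n_i}(b̄_i)`" fed to the
next level, which starts at `b̄_{i+1}`; `τ_b = tanh β`). [cite: Sakai2007, (2.39)] -/
def piKernel (β : ℝ) : ℕ → Finset V → V → V → ℝ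
  | 0, A, v, x => theta G β A v x fun _ => 1
  | k + 1, A, v, x => ∑ d : G.Dart,
      theta G β A v d.fst fun N => Real.tanh β * piKernel β k (clusterOff G N (dartEdge G d) v) d.snd x

/-- The nested `Θ`-kernel of (2.40) with `k + 1` levels (the remainder): innermost
`Σ_b Θ_{v,b̲;𝒜}[ τ_b (⟨φ_b̄ φ_x⟩_Λ - ⟨φ_b̄ φ_x⟩_{𝒞^b_{m+n}(v)ᶜ}) ]` ((2.37) for one level), nested as
`piKernel`. [cite: Sakai2007, (2.40) and (2.37)] -/
def rKernel (β : ℝ) : ℕ → Finset V → V → V → ℝ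
  | 0, A, v, x => ∑ d : G.Dart, theta G β A v d.fst fun N => Real.tanh β *
      (isingTwoPoint G univ β 0 .free d.snd x - twoPointOff G β (clusterOff G N (dartEdge G d) v) d.snd x)
  | k + 1, A, v, x => ∑ d : G.Dart,
      theta G β A v d.fst fun N => Real.tanh β * rKernel β k (clusterOff G N (dartEdge G d) v) d.snd x

/-- **Sakai's expansion coefficient `π^{(j)}_Λ(x)`** (origin `o`): `π^{(0)}_Λ(x) = Θ_{o,x;Λ}[1]`
((2.36)) and, for `j ≥ 1`, the `j`-fold nesting (2.39); i.e. `F_j(Λ, o, x)`.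
[cite: Sakai2007, (2.36) and (2.39)] -/
def coeff (β : ℝ) (o : V) (j : ℕ) (x : V) : ℝ := piKernel G β j univ o x

/-- **Sakai's remainder `R^{(j)}_Λ(x)`** for `j ≥ 1` ((2.37), (2.40)): `remainder β o (k+1) x`
is the `(k+1)`-fold nesting; `R^{(0)}` is not defined in the source and is set to `0`.
[cite: Sakai2007, (2.37) and (2.40)] -/
def remainder (β : ℝ) (o : V) : ℕ → V → ℝ
  | 0, _ => 0
  | k + 1, x => rKernel G β k univ o x

/-- The alternating partial sums `Π^{(j)}_Λ(x) = Σ_{i ≤ j} (-1)^i π^{(i)}_Λ(x)` ((1.12)).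
[cite: Sakai2007, (1.12)] -/
def coeffSum (β : ℝ) (o : V) (j : ℕ) (x : V) : ℝ :=
  ∑ i ∈ Finset.range (j + 1), (-1 : ℝ) ^ i * coeff G β o i x

/-! ## Proposition 1.1 for these objects (named fact) -/

/-- NAMED FACT — **Sakai 2007, Proposition 1.1 with the ferromagnetic bounds (1.13)**, for the
Ising model with uniform coupling `β ≥ 0` on a finite simple graph (`Λ` = the vertex set,
`𝔹_Λ = E(G)`, `τ_{u,v} = tanh β · 1{u ∼ v}`) and the coefficients of §2.2 as defined above:
for every `j ≥ 0` and `x`,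
`⟨φ_oφ_x⟩_Λ = Π^{(j)}(x) + Σ_{(u,v) directed bond} Π^{(j)}(u) τ_{u,v} ⟨φ_vφ_x⟩_Λ + (-1)^{j+1} R^{(j+1)}(x)`
((1.11)), `π^{(j)}(x) ≥ δ_{j,0}δ_{o,x}` and
`0 ≤ R^{(j+1)}(x) ≤ Σ_{(u,v)} π^{(j)}(u) τ_{u,v} ⟨φ_vφ_x⟩_Λ` ((1.13)). "The above proposition
holds independently of the properties of the spin-spin coupling" — here only the ferromagnetic
uniform coupling is transcribed (the identity is printed as valid for every sign of the coupling;
stating it for `β ≥ 0` only is weaker). Printed proof: §2.2 ((2.7)–(2.42), Prop. 2.2, Lemma 2.3).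
Not proved here. [cite: Sakai2007, Proposition 1.1, (1.11)–(1.13), §2.2] -/
def Sakai2007_prop11 : Prop :=
  ∀ (V : Type) [Fintype V] [DecidableEq V] (G : SimpleGraph V) [DecidableRel G.Adj] (β : ℝ),
    0 ≤ β → ∀ (o : V) (j : ℕ) (x : V),
      (isingTwoPoint G univ β 0 .free o x = coeffSum G β o j x +
          (∑ d : G.Dart, coeffSum G β o j d.fst * Real.tanh β * isingTwoPoint G univ β 0 .free d.snd x) +
          (-1 : ℝ) ^ (j + 1) * remainder G β o (j + 1) x) ∧
      (if j = 0 ∧ x = o then (1 : ℝ) else 0) ≤ coeff G β o j x ∧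
      0 ≤ remainder G β o (j + 1) x ∧
      remainder G β o (j + 1) x ≤
        ∑ d : G.Dart, coeff G β o j d.fst * Real.tanh β * isingTwoPoint G univ β 0 .free d.snd x

/-! ## Bridges to the tree's API and sanity of the transcription -/

variable {G}

omit [DecidableEq V] in
/-- `x ⟷_N y` is membership of `y` in the tree's cluster `C_N(x)`. [folklore] -/
theorem conn_iff_mem_cluster {N : Current G} {x y : V} : Conn G N x y ↔ y ∈ N.cluster x :=
  Current.mem_cluster_iff.symm

omit [DecidableEq V] in
/-- `x ⟷_N y in 𝒜ᶜ` unfolds to the tree's `Current.connIn (offGraph G 𝒜)` (the connection event of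
the nested switching lemma `Current.tsum_switching`) with the endpoint condition. [folklore] -/
theorem connAvoid_iff {N : Current G} {A : Finset V} {x y : V} :
    ConnAvoid G N A x y ↔ x ∉ A ∧ y ∉ A ∧ N ∈ Current.connIn (offGraph G A) x y := Iff.rfl

/-- `𝒞^b_N(x)` is the cluster of `x` once `n_b` is set to `0`. [folklore] -/
theorem clusterOff_eq (N : Current G) (e : G.edgeFinset) (x : V) :
    clusterOff G N e x = Current.cluster (Function.update N e 0) x := rfl

/-- `Θ_{v,x;𝒜}[X] ≥ 0` for `β ≥ 0` and `X ≥ 0` (all weights are nonnegative in the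
ferromagnetic case). [cite: Sakai2007, §2.2.3 ("τ_b and w_𝒜(n) … are nonnegative")] -/
theorem theta_nonneg {β : ℝ} (hβ : 0 ≤ β) (A : Finset V) (v x : V) {X : Current G → ℝ}
    (hX : ∀ N, 0 ≤ X N) : 0 ≤ theta G β A v x X := by
  have hz : ∀ S, 0 ≤ zOff G β S := fun S => tsum_nonneg fun n => by
    split_ifs
    · exact Current.weight_nonneg hβ n
    · exact le_rfl
  refine tsum_nonneg fun p => mul_nonneg (mul_nonneg ?_ ?_) ?_
  · split_ifs
    · exact div_nonneg (Current.weight_nonneg hβ _) (hz _)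
    · exact le_rfl
  · split_ifs
    · exact div_nonneg (Current.weight_nonneg hβ _) (hz _)
    · exact le_rfl
  · split_ifs
    · exact hX _
    · exact le_rfl

/-- The nested kernels are nonnegative for `β ≥ 0`. [cite: Sakai2007, (1.13) (π^{(j)} ≥ 0)] -/
theorem piKernel_nonneg {β : ℝ} (hβ : 0 ≤ β) (k : ℕ) : ∀ (A : Finset V) (v x : V),
    0 ≤ piKernel G β k A v x := by
  have htanh : 0 ≤ Real.tanh β := by
    rw [Real.tanh_eq_sinh_div_cosh]
    exact div_nonneg (Real.sinh_nonneg_iff.2 hβ) (Real.cosh_pos _).le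
  induction k with
  | zero => exact fun A v x => theta_nonneg hβ A v x fun _ => zero_le_one
  | succ k ih =>
    intro A v x
    exact Finset.sum_nonneg fun d _ => theta_nonneg hβ _ _ _ fun N => mul_nonneg htanh (ih _ _ _)

/-- `π^{(j)}_Λ(x) ≥ 0` for `β ≥ 0` (the easy half of (1.13)). [cite: Sakai2007, (1.13)] -/
theorem coeff_nonneg {β : ℝ} (hβ : 0 ≤ β) (o : V) (j : ℕ) (x : V) : 0 ≤ coeff G β o j x :=
  piKernel_nonneg hβ j univ o x

omit [DecidableEq V] in
/-- Nothing is connected "in `Λᶜ = ∅`". [cite: Sakai2007, Definition 2.1 (i)] -/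
theorem not_connAvoid_univ (N : Current G) (x y : V) : ¬ConnAvoid G N univ x y := fun h =>
  h.1 (mem_univ x)

omit [DecidableEq V] in
/-- Connection through the whole volume is plain connection: `{x ⟷ y through Λ} = {x ⟷ y}`.
[cite: Sakai2007, (2.7)] -/
theorem connThrough_univ_iff (N : Current G) (x y : V) : ConnThrough G N univ x y ↔ Conn G N x y :=
  ⟨fun h => h.1, fun h => ⟨h, not_connAvoid_univ N x y⟩⟩

/-- A connection off a bond is a connection. [folklore] -/
theorem ConnOff.conn {N : Current G} {e : G.edgeFinset} {x y : V} (h : ConnOff G N e x y) :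
    Conn G N x y := by
  refine h.mono (Percolation.openGraph_mono fun f hf => ?_)
  obtain ⟨hfG, hpos⟩ := hf
  refine ⟨hfG, ?_⟩
  by_cases hfe : (⟨f, hfG⟩ : G.edgeFinset) = e
  · rw [hfe, Function.update_self] at hpos
    exact absurd hpos (lt_irrefl 0)
  · rwa [Function.update_of_ne hfe] at hpos

/-- **`E_N(o, x; Λ) = {o ⟺_N x}`** (the remark before (2.36)): through `Λ` every connection
qualifies, and a pivotal bond `b` from `o` always has `o ⟷ b̲`. [cite: Sakai2007, §2.2.3 ("Since E_n(o,x;Λ) = {o ⟺ x}")] -/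
theorem laceEvent_univ_iff (N : Current G) (v x : V) : laceEvent G N univ v x ↔ IsDoublyConn G N v x := by
  simp only [laceEvent, IsDoublyConn, connThrough_univ_iff]
  refine and_congr_right fun _ => not_congr ⟨?_, ?_⟩
  · rintro ⟨d, hd, -⟩
    exact ⟨d, hd⟩
  · rintro ⟨d, hd⟩
    exact ⟨d, hd, hd.1.conn⟩

/-- A current supported on `𝔹_∅ = offGraph G Λ` (no bonds) vanishes. [folklore] -/
theorem eq_zero_of_isSupp_offGraph_univ {n : Current G} (h : Current.IsSupp (offGraph G univ) n) :
    n = 0 := by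
  funext e
  refine (isSupp_offGraph_iff.1 h) e fun he => ?_
  rcases e with ⟨e, he'⟩
  induction e using Sym2.ind with
  | _ a b => exact (Current.edgeOff_mk.1 he).1 (mem_univ a)

/-- `zOff` is the real part of the tree's `ℝ≥0∞`-valued supported current sum
`ecurrentSumIn (offGraph G 𝒜) (fun _ => β) ∅` (`β ≥ 0`). [folklore] -/
theorem zOff_eq_toReal_ecurrentSumIn {β : ℝ} (hβ : 0 ≤ β) (A : Finset V) :
    zOff G β A = (ecurrentSumIn (offGraph G A) (fun _ : G.edgeFinset => β) ∅).toReal := by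
  unfold zOff ecurrentSumIn
  rw [ENNReal.tsum_toReal_eq fun n => by split_ifs <;> simp]
  refine tsum_congr fun n => ?_
  split_ifs
  · rw [Current.eweight, ← Current.weight_eq_wweight, ENNReal.toReal_ofReal (Current.weight_nonneg hβ n)]
  · rfl

/-- **`Z_∅ = 1`** (`𝒜 = Λ`): only the zero current lives on no bonds (Sakai's convention
`w_∅(m)/Z_∅ = 1{m ≡ 0}`). [cite: Sakai2007, §2.2.3 (w_∅(m)/Z_∅ = 1{m ≡ 0})] -/
theorem zOff_univ (β : ℝ) : zOff G β univ = 1 := by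
  unfold zOff
  rw [tsum_eq_single 0]
  · simp [Current.isSupp_zero]
  · intro n hn
    rw [if_neg]
    rintro ⟨hs, -⟩
    exact hn (eq_zero_of_isSupp_offGraph_univ hs)

/-- **`Z_Λ = Σ_{∂n=∅} w(n)`** (`𝒜 = ∅`) is the tree's `currentSum G β ∅`. [cite: Sakai2007, (2.3)] -/
theorem zOff_empty (β : ℝ) : zOff G β ∅ = currentSum G β ∅ := by
  unfold zOff currentSum
  refine tsum_congr fun n => ?_
  have : Current.IsSupp (offGraph G ∅) n :=
    isSupp_offGraph_iff.2 fun e he => absurd (fun v _ => Finset.notMem_empty v) he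
  simp only [this, true_and]

open Classical in
/-- **(2.10) = (2.36): `π^{(0)}_Λ(x) = Σ_{∂n = o△x} (w_Λ(n)/Z_Λ) 1{o ⟺_n x}`** — in `Θ_{o,x;Λ}[1]`
the current `m` on `𝔹_∅` vanishes and `Z_∅ = 1`. [cite: Sakai2007, (2.10) and (2.36)] -/
theorem coeff_zero_eq {β : ℝ} (o x : V) :
    coeff G β o 0 x = ∑' n : Current G,
      if n.sources = {o} ∆ {x} ∧ IsDoublyConn G n o x then n.weight β / currentSum G β ∅ else 0 := by
  unfold coeff piKernel theta
  rw [zOff_univ, zOff_empty]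
  -- the pair sum is supported on `{0} × currents`
  have hsupp : ∀ p : Current G × Current G,
      (if Current.IsSupp (offGraph G univ) p.1 ∧ p.1.sources = ∅ then p.1.weight β / 1 else 0) *
        (if p.2.sources = {o} ∆ {x} then p.2.weight β / currentSum G β ∅ else 0) *
        (if laceEvent G (p.1 + p.2) univ o x then (1 : ℝ) else 0) ≠ 0 →
        p ∈ Set.range fun n : Current G => ((0 : Current G), n) := by
    intro p hp
    refine ⟨p.2, ?_⟩
    have h1 : Current.IsSupp (offGraph G univ) p.1 := by
      by_contra h
      apply hp
      rw [if_neg (fun h' => h h'.1), zero_mul, zero_mul]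
    rw [Prod.ext_iff]
    exact ⟨(eq_zero_of_isSupp_offGraph_univ h1).symm, rfl⟩
  rw [← Function.Injective.tsum_eq (f := fun p : Current G × Current G =>
      (if Current.IsSupp (offGraph G univ) p.1 ∧ p.1.sources = ∅ then p.1.weight β / 1 else 0) *
        (if p.2.sources = {o} ∆ {x} then p.2.weight β / currentSum G β ∅ else 0) *
        (if laceEvent G (p.1 + p.2) univ o x then (1 : ℝ) else 0))
      (g := fun n : Current G => ((0 : Current G), n)) (fun a b h => (Prod.ext_iff.1 h).2)
      (fun p hp => hsupp p hp)]
  refine tsum_congr fun n => ?_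
  simp only [Current.isSupp_zero, Current.sources_zero, true_and, if_true, Current.weight_zero,
    div_one, one_mul, zero_add, laceEvent_univ_iff]
  by_cases hs : n.sources = {o} ∆ {x}
  · by_cases hd : IsDoublyConn G n o x
    · rw [if_pos hs, if_pos hd, if_pos ⟨hs, hd⟩, mul_one]
    · rw [if_pos hs, if_neg hd, if_neg (fun h => hd h.2), mul_zero]
  · rw [if_neg hs, zero_mul, if_neg (fun h => hs h.1)]

end IsingLace

end Literature.Probability.LatticeModels

end
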